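import Summits.BirchSwinnertonDyer.Rank1Residual.AdditivePotMult.PotMultRankOneKatoCertificateBSD
import Summits.BirchSwinnertonDyer.Rank1Residual.AdditivePotMult.PotMultRankOneWuthrichCertificate
import HarnessLib

/-!
# X4(M) / X3♯(M) at analytic rank ONE on the ODD branch (`p ≡ 3 (mod 4)`, `p = 3` included):
# the §7 one-number certificate forms of `PotMultRankOneKatoCertificateBSD.lean` WITHOUT Pal's
# hypothesis `hPal` (cell `b2b-bsdres`, team n1011, seat p12 (gen 2); lead GEN 6 R5-26 / R5-27:
# "the Pal-free odd §7 twins of T-O7KM as a sibling file"; referee-1 proviso on row T-O7KM)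

HONEST FRAMING (cell `b2b-bsdres`, run/shared/lean/b2b/bsd-rank1-residual/, verbatim in every
file): the goal of the cell is to DELETE the COMBINATION-SHAPED residual classes of the
Birch–Swinnerton-Dyer formula for ALL analytic-rank `≤ 1` elliptic curves over `ℚ` — "full BSD
formula for every rank `≤ 1` curve in class `C`" assembled STRICTLY from published theorems — so
that the rank-`≤ 1` remainder becomes exactly the CONSTRUCTION-SHAPED classes, which are TYPED
(missing-input `Prop`s), NOT attempted. This is not "finishing BSD". Team n1011 (RESIDUAL-MAP §I
O7-ord, (M) share: X4(M) ∧ surj(p) resp. X3♯(M), `r_an = 1`, `p ≡ 3 (mod 4)`): research route on the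
CONSTRUCTION-SHAPED class O7; labels and marks UNCHANGED; nothing booked; NO Literature fact minted;
no definition. THEOREMS ONLY; named facts enter as HYPOTHESES (`hK` = Kato's half-eigen reading
`Wuthrich2014.kato_halfEigenCharIdeal_dvd_cyclotomicPrime_of_surjective`; `hW16` = Wuthrich 2014
Thm. 16 `Wuthrich2014.thm16_halfEigenCharIdeal_dvd_cyclotomicPrime`; GZK `hGZK`; modularity `hmod`,
`hmodD`). **NO `hPal` anywhere in this file**: on the odd branch (twist by `−p`) Pal 2012 Thm. 3.2 for
`d < 0` is a TREE THEOREM (`realPeriodRat_mul_sqrt_of_twist_of_neg`, inside additive-p4's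
`entireLFunction_one_eq_of_twist_neg`). No `_holds` of a named fact; debt 0.

## Why this file exists

n1011-p07's `PotMultRankOneKatoCertificateBSD.lean` §7 proves the constant-term half of the
one-number certificate `MultBranchUnitCertificateAt W p` for BOTH parities of `(p−1)/2` in ONE
statement and therefore carries Pal's even-branch hypothesis
`hPal : Pal2012.thm32_sqrt_mul_realPeriodRat_twist_eq_of_prime_one_mod_four` uniformly — also in
`multBranchUnitCertificateAt_of_firstUnitIndex_one_odd` and in the headline
`ClassX4M.bsdp_iff_padicVal_rankOne_of_katoHalf_of_norm_coeff_one`, where at `p ≡ 3 (mod 4)` it is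
NOT USED (referee 1's proviso on row T-O7KM: the (M) rank-one line at `p = 3` may be quoted
"Pal-free" only once the odd twins exist without the binder). Nothing is restated: every proof is
p07's odd branch verbatim or a one-line call of p07's / this seat's X3♯(M) theorems BY NAME.

## What this file proves (`p ≡ 3 (mod 4)` throughout; `3 ≡ 3 (mod 4)`)

* §1 `constantCoeff_minusBranchMult_eq_zero_of_entireLFunction_one_eq_zero` (census-literal odd
  shape: twist `−p`, `Ω⁻`, `L_p⁻`) and `…_multBranch_…_of_mod_four_eq_three` (p07's uniform
  `if Even (p/2)` shape): `L(E,1) = 0` ⟹ the Néron-normalised multiplicative odd branch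
  `ϖ·L_p⁻(f♭, a_p, ω^{(p−1)/2}, T)` of `E♭` has constant term `0`. NO `hPal`.
* §2 the certificate from ONE number, Pal-free: `multBranchUnitCertificateAt_of_norm_coeff_one_of_mod_four_eq_three`
  (uniform shape), `multBranchUnitCertificateAt_of_norm_minusCoeff_one` (literal odd shape), the Q6
  INTERLOCK `multBranchUnitCertificateAt_of_firstUnitIndex_one_of_mod_four_eq_three` (census-ctyper1's
  record `CensusQ6.MultOddFirstUnitIndexAt W p 1` ⟹ the certificate) and, conversely,
  `multOddFirstUnitIndexAt_one_of_norm_minusCoeff_one` (when `L(E,1) = 0` the record's `m = 0`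
  clause is AUTOMATIC).
* §3 headlines, X4(M) ∧ surj (Kato `hK`) and X3♯(M) (Wuthrich Thm. 16 `hW16`, NO surj), `r_an = 1`:
  `BSD(E,p) ⟺ ord_p q + ord_p Reg_p(E,Dh) = 1` (`L'(E,1) = q·Ω_E·Reg_∞`) from ONE unit linear
  coefficient or from the Q6 record; §4 the `p = 3` specialisations.

Binder ledger (all explicit): `hK` / `hW16` (published, half-eigen divisibility), `hmodD`, `hGZK`,
`hmod`, class predicate, `Surj W p` (X4 side only), `r_an = 1`, the ONE-NUMBER input (`hone` /
`CensusQ6.MultOddFirstUnitIndexAt W p 1` — EVIDENCE-tier per pair, census lane), a (B)-datum `Dh` with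
`LeadingTermClauses`, `q`. NO `hPal`, NO `5 ≤ p`, NO `¬CM`, NO `ReductionNonAnomalous`, NO `ℓ_p`, NO
tower. Nothing booked; O7 OPEN; X3 / X4 CONSTRUCTION-SHAPED.

References: K. Kato, Astérisque 295 (2004) Thm. 17.4 (3) [Kato2004Asterisque]; C. Wuthrich, Doc.
Math. 19 (2014) Thm. 16 [Wuthrich2014]; D. Delbourgo, J. Number Theory 95 (2002) Thm. (A), (B)
[Delbourgo2002]; B. Mazur, J. Tate, J. Teitelbaum, Invent. Math. 84 (1986) §I.10, §I.13–I.14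
[MazurTateTeitelbaum1986Invent]; A. Pal, Canad. Math. Bull. 55 (2012) Thm. 3.2 (the `d < 0` case, a
tree theorem) [Pal2012]; R. L. Miller, LMS J. Comput. Math. 14 (2011) Def. 1.1 [Miller2011LMS].
-/

noncomputable section

open scoped Classical MatrixGroups ModularForm NumberField

namespace Summit.BirchSwinnertonDyer.Rank1Residual.AdditivePotMult

open CongruenceSubgroup WeierstrassCurve NumberField Literature.NumberTheory.EllipticCurves
  Literature.NumberTheory.EllipticCurves.ModularForms
  Literature.NumberTheory.EllipticCurves.Rank1Residual
  Literature.NumberTheory.EllipticCurves.Rank1Residual.Typed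
  Literature.NumberTheory.EllipticCurves.Delbourgo2002
  Literature.NumberTheory.GaloisRepresentations
  Summit.BirchSwinnertonDyer.Rank1Residual.Additive
  Summit.BirchSwinnertonDyer.Rank1Residual.X1.MuLambda
  Summit.BirchSwinnertonDyer.Rank1Residual.X1.RankOneParitySqueeze
  IsDedekindDomain

section OddBranch

variable {W : WeierstrassCurve ℚ} [W.IsElliptic] [W.IsGloballyMinimal] {p : ℕ} [hp : Fact p.Prime]

/-! ### §1 The constant-term half on the ODD branch is a THEOREM when `L(E,1) = 0` — no `hPal` -/

/-- **Constant term `0` on the odd branch, census-literal shape, NO `hPal`.** For `E = W` additive at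
`p ≡ 3 (mod 4)` with `L(E,1) = 0`, `V = E♭` globally minimal and MULTIPLICATIVE at `p` with
`C • V^{(−p)} = W`, `f` the newform of `V`, `a_p(f) = ap`, and `ϖ·|Ω⁻_V| = Ω⁻_f`:
`constantCoeff (ϖ·L_p⁻(f, ap, ω^{(p−1)/2}, T)) = 0` — by INTERPOLATION
(`B(0) = ap⁻¹·∑_a (a/p)[a/p]⁻_f`, additive-p4's `constantCoeff_padicLFunctionMinusBranchMult_half`,
`p ∣ N`, `ap = ±1`) and the ODD Birch formula with Pal's `d < 0` relation PROVED in the tree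
(additive-p4's `entireLFunction_one_eq_of_twist_neg`). p07's odd branch, verbatim.
[cite: MazurTateTeitelbaum1986Invent, §I.13–I.14] [cite: Pal2012, Thm. 3.2] -/
theorem constantCoeff_minusBranchMult_eq_zero_of_entireLFunction_one_eq_zero
    (hmod : hasEntireLFunction_rat) (hp4 : p % 4 = 3) (hadd : Addv W p) (hL : W.entireLFunction 1 = 0)
    (V : WeierstrassCurve ℚ) [V.IsElliptic] [V.IsGloballyMinimal] (C : VariableChange ℚ)
    (hV : Mult V p) (hC : C • V.quadraticTwist (-(p : ℚ)) = W)
    {N : ℕ} [NeZero N] {f : CuspForm (Gamma0 N) 2} (hf : IsNewformOf V f) {ap : ℤ}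
    (hap : cuspCoeff f p = ap) (ϖ : ℚ) (hϖ : (ϖ : ℝ) * V.imaginaryPeriodRat = minusPeriod f) :
    PowerSeries.constantCoeff (PowerSeries.C (ϖ : ℚ_[p]) *
        padicLFunctionMinusBranchMult f (ap : ℚ_[p]) (p / 2)) = 0 := by
  have hp2 : p ≠ 2 := by omega
  have hΩ : (W.realPeriodRat : ℂ) ≠ 0 := by exact_mod_cast W.realPeriodRat_pos_holds.ne'
  -- `p ∣ N` and `ap = ±1`
  have hpN_ap : p ∣ N ∧ (ap = 1 ∨ ap = -1) := by
    by_cases hs : V.HasSplitMultiplicativeReductionAtPrime p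
    · obtain ⟨h1, -⟩ := hf.cuspCoeff_eq_one_and_sq_of_split hs
      refine ⟨hf.dvd_level_of_split hs, Or.inl ?_⟩
      have : ((ap : ℤ) : ℂ) = ((1 : ℤ) : ℂ) := by push_cast; exact_mod_cast hap.symm.trans h1
      exact_mod_cast this
    · obtain ⟨h1, hpN⟩ := hf.cuspCoeff_eq_neg_one_and_dvd_of_nonsplit hV hs
      refine ⟨hpN, Or.inr ?_⟩
      have : ((ap : ℤ) : ℂ) = ((-1 : ℤ) : ℂ) := by push_cast; exact_mod_cast hap.symm.trans h1
      exact_mod_cast this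
  obtain ⟨hpN, hap1⟩ := hpN_ap
  have hap0 : (ap : ℚ_[p]) ≠ 0 := by
    rcases hap1 with rfl | rfl <;> norm_num
  rw [map_mul, PowerSeries.constantCoeff_C,
    constantCoeff_padicLFunctionMinusBranchMult_half p hp2 hf.1 hf.coeffField_eq_bot hpN hap hap0]
  obtain ⟨ε, hε, hLq⟩ := entireLFunction_one_eq_of_twist_neg p hmod hp4 V W C hC hadd hf ϖ hϖ
  rw [hL] at hLq
  have hzero : ε * (ϖ * legendreMinusSymbolSum f p) /
      (|(C.u : ℚ)| * ((W.baseChange ℝ).numRealComponents : ℚ)) = 0 := by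
    exact_mod_cast (mul_eq_zero.mp hLq.symm).resolve_right hΩ
  have hε0 : ε ≠ 0 := by rcases hε with rfl | rfl <;> norm_num
  have hua0 : |(C.u : ℚ)| ≠ 0 := abs_ne_zero.mpr C.u.ne_zero
  have hcinf0 : ((W.baseChange ℝ).numRealComponents : ℚ) ≠ 0 := by
    rw [numRealComponents]
    split_ifs <;> norm_num
  have hϖS : ϖ * legendreMinusSymbolSum f p = 0 := by
    rcases div_eq_zero_iff.mp hzero with h | h
    · exact (mul_eq_zero.mp h).resolve_left hε0
    · exact absurd h (mul_ne_zero hua0 hcinf0)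
  have hϖS' : (ϖ : ℚ_[p]) * (legendreMinusSymbolSum f p : ℚ_[p]) = 0 := by exact_mod_cast hϖS
  calc (ϖ : ℚ_[p]) * ((ap : ℚ_[p])⁻¹ * (legendreMinusSymbolSum f p : ℚ_[p]))
      = (ap : ℚ_[p])⁻¹ * ((ϖ : ℚ_[p]) * (legendreMinusSymbolSum f p : ℚ_[p])) := by ring
    _ = 0 := by rw [hϖS', mul_zero]

/-- **Pal-free odd twin of p07's `constantCoeff_multBranch_eq_zero_of_entireLFunction_one_eq_zero`**
(uniform `if Even (p/2)` shape of the def `MultBranchUnitCertificateAt`, `p ≡ 3 (mod 4)`): the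
Néron-normalised multiplicative branch of `E♭` has constant term `0` when `L(E,1) = 0`. NO `hPal`.
[cite: MazurTateTeitelbaum1986Invent, §I.13–I.14] [cite: Pal2012, Thm. 3.2] -/
theorem constantCoeff_multBranch_eq_zero_of_entireLFunction_one_eq_zero_of_mod_four_eq_three
    (hmod : hasEntireLFunction_rat) (hp4 : p % 4 = 3) (hadd : Addv W p) (hL : W.entireLFunction 1 = 0)
    (V : WeierstrassCurve ℚ) [V.IsElliptic] [V.IsGloballyMinimal] (C : VariableChange ℚ)
    (hV : Mult V p) (hC : C • V.quadraticTwist ((-1 : ℚ) ^ (p / 2) * p) = W)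
    {N : ℕ} [NeZero N] {f : CuspForm (Gamma0 N) 2} (hf : IsNewformOf V f) {ap : ℤ}
    (hap : cuspCoeff f p = ap) (ϖ : ℚ)
    (hϖ : if Even (p / 2) then (ϖ : ℝ) * V.realPeriodRat = plusPeriod f
      else (ϖ : ℝ) * V.imaginaryPeriodRat = minusPeriod f) :
    PowerSeries.constantCoeff (PowerSeries.C (ϖ : ℚ_[p]) *
        (if Even (p / 2) then padicLFunctionPlusBranchMult f (ap : ℚ_[p]) (p / 2)
          else padicLFunctionMinusBranchMult f (ap : ℚ_[p]) (p / 2))) = 0 := by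
  have hnot : ¬ Even (p / 2) := by rw [Nat.not_even_iff_odd]; exact ⟨p / 4, by omega⟩
  have hC' : C • V.quadraticTwist (-(p : ℚ)) = W := by
    rw [pStar_eq_neg_of_mod_four_eq_three hp4] at hC; exact hC
  rw [if_neg hnot] at hϖ ⊢
  exact constantCoeff_minusBranchMult_eq_zero_of_entireLFunction_one_eq_zero hmod hp4 hadd hL V C hV
    hC' hf hap ϖ hϖ

/-! ### §2 The certificate from ONE number, Pal-free; the Q6 odd record at index `1` ⟺ one unit -/

/-- **Pal-free odd twin of p07's `multBranchUnitCertificateAt_of_norm_coeff_one`** (`p ≡ 3 (mod 4)`,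
uniform shape): `L(E,1) = 0` and every Néron-normalised multiplicative branch of the twist having a
linear coefficient of `p`-adic norm `1` (`hone`, the per-pair computation) ⟹
`MultBranchUnitCertificateAt W p`. NO `hPal`. [cite: MazurTateTeitelbaum1986Invent, §I.13–I.14] -/
theorem multBranchUnitCertificateAt_of_norm_coeff_one_of_mod_four_eq_three
    (hmod : hasEntireLFunction_rat) (hp4 : p % 4 = 3) (hadd : Addv W p) (hL : W.entireLFunction 1 = 0)
    (hone : ∀ (V : WeierstrassCurve ℚ) [V.IsElliptic] [V.IsGloballyMinimal] (C : VariableChange ℚ),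
      Mult V p → C • V.quadraticTwist ((-1 : ℚ) ^ (p / 2) * p) = W →
      ∀ {N : ℕ} [NeZero N] (f : CuspForm (Gamma0 N) 2), IsNewformOf V f → ∀ (ap : ℤ), cuspCoeff f p = ap →
      ∀ ϖ : ℚ, (if Even (p / 2) then (ϖ : ℝ) * V.realPeriodRat = plusPeriod f
          else (ϖ : ℝ) * V.imaginaryPeriodRat = minusPeriod f) →
        ‖PowerSeries.coeff 1 (PowerSeries.C (ϖ : ℚ_[p]) *
            (if Even (p / 2) then padicLFunctionPlusBranchMult f (ap : ℚ_[p]) (p / 2)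
              else padicLFunctionMinusBranchMult f (ap : ℚ_[p]) (p / 2)))‖ = 1) :
    MultBranchUnitCertificateAt W p :=
  fun V _ _ C hV hC _ _ f hf ap hap ϖ hϖ ↦
    ⟨constantCoeff_multBranch_eq_zero_of_entireLFunction_one_eq_zero_of_mod_four_eq_three hmod hp4 hadd
      hL V C hV hC hf hap ϖ hϖ, hone V C hV hC f hf ap hap ϖ hϖ⟩

/-- **The certificate from ONE number, census-literal odd shape** (`p ≡ 3 (mod 4)`; twist `−p`, `Ω⁻`,
`L_p⁻`): `L(E,1) = 0` and, for every multiplicative model `V` of `E ⊗ χ_{−p}` (newform `f`, `a_p`,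
odd period ratio `ϖ`), `‖coeff₁(ϖ·L_p⁻(f, a_p, ω^{(p−1)/2}, T))‖ = 1` ⟹ `MultBranchUnitCertificateAt W p`.
NO `hPal`. [cite: MazurTateTeitelbaum1986Invent, §I.13–I.14] -/
theorem multBranchUnitCertificateAt_of_norm_minusCoeff_one
    (hmod : hasEntireLFunction_rat) (hp4 : p % 4 = 3) (hadd : Addv W p) (hL : W.entireLFunction 1 = 0)
    (hone : ∀ (V : WeierstrassCurve ℚ) [V.IsElliptic] [V.IsGloballyMinimal] (C : VariableChange ℚ),
      Mult V p → C • V.quadraticTwist (-(p : ℚ)) = W →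
      ∀ {N : ℕ} [NeZero N] (f : CuspForm (Gamma0 N) 2), IsNewformOf V f → ∀ (ap : ℤ), cuspCoeff f p = ap →
      ∀ ϖ : ℚ, (ϖ : ℝ) * V.imaginaryPeriodRat = minusPeriod f →
        ‖PowerSeries.coeff 1 (PowerSeries.C (ϖ : ℚ_[p]) *
            padicLFunctionMinusBranchMult f (ap : ℚ_[p]) (p / 2))‖ = 1) :
    MultBranchUnitCertificateAt W p := by
  have hnot : ¬ Even (p / 2) := by rw [Nat.not_even_iff_odd]; exact ⟨p / 4, by omega⟩
  intro V _ _ C hV hC N _ f hf ap hap ϖ hϖ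
  have hC' : C • V.quadraticTwist (-(p : ℚ)) = W := by
    rw [pStar_eq_neg_of_mod_four_eq_three hp4] at hC; exact hC
  rw [if_neg hnot] at hϖ ⊢
  exact ⟨constantCoeff_minusBranchMult_eq_zero_of_entireLFunction_one_eq_zero hmod hp4 hadd hL V C hV
    hC' hf hap ϖ hϖ, hone V C hV hC' f hf ap hap ϖ hϖ⟩

/-- **Q6 INTERLOCK, odd branch, Pal-free** (twin of p07's
`multBranchUnitCertificateAt_of_firstUnitIndex_one_odd` WITHOUT the idle `hPal`): census-ctyper1's
record `CensusQ6.MultOddFirstUnitIndexAt W p 1` ("the first `p`-adic unit coefficient of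
`ϖ·L_p⁻(f, a_p, ω^{(p−1)/2}, T)` sits at index `1`") and `L(E,1) = 0` ⟹ `MultBranchUnitCertificateAt W p`.
[cite: MazurTateTeitelbaum1986Invent, §I.13] -/
theorem multBranchUnitCertificateAt_of_firstUnitIndex_one_of_mod_four_eq_three
    (hmod : hasEntireLFunction_rat) (hp4 : p % 4 = 3) (hadd : Addv W p) (hL : W.entireLFunction 1 = 0)
    (hrec : CensusQ6.MultOddFirstUnitIndexAt W p 1) : MultBranchUnitCertificateAt W p :=
  multBranchUnitCertificateAt_of_norm_minusCoeff_one hmod hp4 hadd hL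
    fun V _ _ C hV hC _ _ f hf ap hap ϖ hϖ ↦ (hrec V C hV hC f hf ap hap ϖ hϖ).2

/-- **Conversely, when `L(E,1) = 0` the record's `m = 0` clause is AUTOMATIC**: one unit linear
coefficient on every multiplicative model of `E ⊗ χ_{−p}` ⟹ the Q6 odd record
`CensusQ6.MultOddFirstUnitIndexAt W p 1` (the constant coefficient is `0`, of norm `0 < 1`, by §1).
So on `r_an ≥ 1` rows the Q6 odd record at index `1` and "one unit linear coefficient" are the SAME
datum. [cite: MazurTateTeitelbaum1986Invent, §I.13] -/
theorem multOddFirstUnitIndexAt_one_of_norm_minusCoeff_one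
    (hmod : hasEntireLFunction_rat) (hp4 : p % 4 = 3) (hadd : Addv W p) (hL : W.entireLFunction 1 = 0)
    (hone : ∀ (V : WeierstrassCurve ℚ) [V.IsElliptic] [V.IsGloballyMinimal] (C : VariableChange ℚ),
      Mult V p → C • V.quadraticTwist (-(p : ℚ)) = W →
      ∀ {N : ℕ} [NeZero N] (f : CuspForm (Gamma0 N) 2), IsNewformOf V f → ∀ (ap : ℤ), cuspCoeff f p = ap →
      ∀ ϖ : ℚ, (ϖ : ℝ) * V.imaginaryPeriodRat = minusPeriod f →
        ‖PowerSeries.coeff 1 (PowerSeries.C (ϖ : ℚ_[p]) *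
            padicLFunctionMinusBranchMult f (ap : ℚ_[p]) (p / 2))‖ = 1) :
    CensusQ6.MultOddFirstUnitIndexAt W p 1 := by
  intro V _ _ C hV hC N _ f hf ap hap ϖ hϖ
  refine ⟨fun m hm ↦ ?_, hone V C hV hC f hf ap hap ϖ hϖ⟩
  obtain rfl : m = 0 := by omega
  rw [PowerSeries.coeff_zero_eq_constantCoeff_apply,
    constantCoeff_minusBranchMult_eq_zero_of_entireLFunction_one_eq_zero hmod hp4 hadd hL V C hV hC hf
      hap ϖ hϖ, norm_zero]
  exact zero_lt_one

/-! ### §3 Headlines on the odd branch, Pal-free: X4(M) ∧ surj (Kato) and X3♯(M) (Wuthrich Thm. 16) -/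

/-- **HEADLINE, Pal-free odd twin of p07's
`ClassX4M.bsdp_iff_padicVal_rankOne_of_katoHalf_of_norm_coeff_one`** (X4(M) ∩ {`ρ̄` onto},
`p ≡ 3 (mod 4)`, `r_an = 1`): `BSD(E,p) ⟺ ord_p q + ord_p Reg_p(E,Dh) = 1` for every (B)-datum `Dh`
(`L'(E,1) = q·Ω_E·Reg_∞`), GIVEN Kato's divisibility `hK` and ONE `p`-adic unit (`hone`, uniform shape).
NO `hPal`. [cite: Kato2004Asterisque, Thm. 17.4 (3) (p. 273)] [cite: Delbourgo2002, Theorem (B) (p. 40)]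
[cite: Miller2011LMS, Def. 1.1] -/
theorem ClassX4M.bsdp_iff_padicVal_rankOne_of_katoHalf_of_norm_coeff_one_of_mod_four_eq_three
    (hK : Wuthrich2014.kato_halfEigenCharIdeal_dvd_cyclotomicPrime_of_surjective)
    (hmodD : nonempty_modularParametrizationData)
    (hGZK : rank_eq_analyticRank_of_analyticRank_le_one) (hmod : hasEntireLFunction_rat)
    (hp4 : p % 4 = 3) (hX : ClassX4M W p) (hsurj : Surj W p) (hr : W.analyticRank = 1)
    (hone : ∀ (V : WeierstrassCurve ℚ) [V.IsElliptic] [V.IsGloballyMinimal] (C : VariableChange ℚ),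
      Mult V p → C • V.quadraticTwist ((-1 : ℚ) ^ (p / 2) * p) = W →
      ∀ {N : ℕ} [NeZero N] (f : CuspForm (Gamma0 N) 2), IsNewformOf V f → ∀ (ap : ℤ), cuspCoeff f p = ap →
      ∀ ϖ : ℚ, (if Even (p / 2) then (ϖ : ℝ) * V.realPeriodRat = plusPeriod f
          else (ϖ : ℝ) * V.imaginaryPeriodRat = minusPeriod f) →
        ‖PowerSeries.coeff 1 (PowerSeries.C (ϖ : ℚ_[p]) *
            (if Even (p / 2) then padicLFunctionPlusBranchMult f (ap : ℚ_[p]) (p / 2)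
              else padicLFunctionMinusBranchMult f (ap : ℚ_[p]) (p / 2)))‖ = 1)
    {Dh : PAdicHeightData W p} (hB : LeadingTermClauses W p Dh)
    {q : ℚ} (hLq : W.leadingLCoeff = (q : ℂ) * (W.realPeriodRat : ℂ) * (W.regulator : ℂ)) :
    BSDp W p ↔ padicValRat p q + (padicRegulator Dh).valuation = 1 :=
  hX.bsdp_iff_padicVal_rankOne_of_katoHalf_of_multCert hK hmodD hGZK hmod hsurj hr
    (multBranchUnitCertificateAt_of_norm_coeff_one_of_mod_four_eq_three hmod hp4 hX.classX4.2.1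
      (entireLFunction_one_eq_zero_of_analyticRank_ne_zero hmod (by rw [hr]; exact one_ne_zero)) hone)
    hB hLq

/-- **HEADLINE from the Q6 RECORD** (X4(M) ∩ {`ρ̄` onto}, `p ≡ 3 (mod 4)`, `r_an = 1`): Kato `hK` +
census-ctyper1's `CensusQ6.MultOddFirstUnitIndexAt W p 1` ⟹ `BSD(E,p) ⟺ ord_p q + ord_p Reg_p(E,Dh) = 1`.
NO `hPal`. [cite: Kato2004Asterisque, Thm. 17.4 (3) (p. 273)] [cite: Delbourgo2002, Theorem (B) (p. 40)]
[cite: Miller2011LMS, Def. 1.1] -/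
theorem ClassX4M.bsdp_iff_padicVal_rankOne_of_katoHalf_of_firstUnitIndex_one_of_mod_four_eq_three
    (hK : Wuthrich2014.kato_halfEigenCharIdeal_dvd_cyclotomicPrime_of_surjective)
    (hmodD : nonempty_modularParametrizationData)
    (hGZK : rank_eq_analyticRank_of_analyticRank_le_one) (hmod : hasEntireLFunction_rat)
    (hp4 : p % 4 = 3) (hX : ClassX4M W p) (hsurj : Surj W p) (hr : W.analyticRank = 1)
    (hrec : CensusQ6.MultOddFirstUnitIndexAt W p 1)
    {Dh : PAdicHeightData W p} (hB : LeadingTermClauses W p Dh)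
    {q : ℚ} (hLq : W.leadingLCoeff = (q : ℂ) * (W.realPeriodRat : ℂ) * (W.regulator : ℂ)) :
    BSDp W p ↔ padicValRat p q + (padicRegulator Dh).valuation = 1 :=
  hX.bsdp_iff_padicVal_rankOne_of_katoHalf_of_multCert hK hmodD hGZK hmod hsurj hr
    (multBranchUnitCertificateAt_of_firstUnitIndex_one_of_mod_four_eq_three hmod hp4 hX.classX4.2.1
      (entireLFunction_one_eq_zero_of_analyticRank_ne_zero hmod (by rw [hr]; exact one_ne_zero)) hrec)
    hB hLq

/-- **X3♯(M) HEADLINE, Pal-free, odd branch** (`p ≡ 3 (mod 4)`, `r_an = 1`; Wuthrich Thm. 16 `hW16`,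
NO surj): `BSD(E,p) ⟺ ord_p q + ord_p Reg_p(E,Dh) = 1` from ONE `p`-adic unit (`hone`, uniform
shape) — over this seat's `ClassX3M.bsdp_iff_padicVal_rankOne_of_wuthrichHalf_of_multCert`.
[cite: Wuthrich2014, Thm. 16 (p. 397)] [cite: Delbourgo2002, Theorem (B) (p. 40)] [cite: Miller2011LMS, Def. 1.1] -/
theorem ClassX3M.bsdp_iff_padicVal_rankOne_of_wuthrichHalf_of_norm_coeff_one_of_mod_four_eq_three
    (hW16 : Wuthrich2014.thm16_halfEigenCharIdeal_dvd_cyclotomicPrime)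
    (hmodD : nonempty_modularParametrizationData)
    (hGZK : rank_eq_analyticRank_of_analyticRank_le_one) (hmod : hasEntireLFunction_rat)
    (hp4 : p % 4 = 3) (hX : ClassX3M W p) (hr : W.analyticRank = 1)
    (hone : ∀ (V : WeierstrassCurve ℚ) [V.IsElliptic] [V.IsGloballyMinimal] (C : VariableChange ℚ),
      Mult V p → C • V.quadraticTwist ((-1 : ℚ) ^ (p / 2) * p) = W →
      ∀ {N : ℕ} [NeZero N] (f : CuspForm (Gamma0 N) 2), IsNewformOf V f → ∀ (ap : ℤ), cuspCoeff f p = ap →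
      ∀ ϖ : ℚ, (if Even (p / 2) then (ϖ : ℝ) * V.realPeriodRat = plusPeriod f
          else (ϖ : ℝ) * V.imaginaryPeriodRat = minusPeriod f) →
        ‖PowerSeries.coeff 1 (PowerSeries.C (ϖ : ℚ_[p]) *
            (if Even (p / 2) then padicLFunctionPlusBranchMult f (ap : ℚ_[p]) (p / 2)
              else padicLFunctionMinusBranchMult f (ap : ℚ_[p]) (p / 2)))‖ = 1)
    {Dh : PAdicHeightData W p} (hB : LeadingTermClauses W p Dh)
    {q : ℚ} (hLq : W.leadingLCoeff = (q : ℂ) * (W.realPeriodRat : ℂ) * (W.regulator : ℂ)) :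
    BSDp W p ↔ padicValRat p q + (padicRegulator Dh).valuation = 1 :=
  hX.bsdp_iff_padicVal_rankOne_of_wuthrichHalf_of_multCert hW16 hmodD hGZK hmod hr
    (multBranchUnitCertificateAt_of_norm_coeff_one_of_mod_four_eq_three hmod hp4 hX.potMult.1
      (entireLFunction_one_eq_zero_of_analyticRank_ne_zero hmod (by rw [hr]; exact one_ne_zero)) hone)
    hB hLq

/-- **X3♯(M) HEADLINE from the Q6 RECORD** (`p ≡ 3 (mod 4)`, `r_an = 1`; Wuthrich Thm. 16, NO surj):
`CensusQ6.MultOddFirstUnitIndexAt W p 1` ⟹ `BSD(E,p) ⟺ ord_p q + ord_p Reg_p(E,Dh) = 1`. NO `hPal`.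
[cite: Wuthrich2014, Thm. 16 (p. 397)] [cite: Delbourgo2002, Theorem (B) (p. 40)] [cite: Miller2011LMS, Def. 1.1] -/
theorem ClassX3M.bsdp_iff_padicVal_rankOne_of_wuthrichHalf_of_firstUnitIndex_one_of_mod_four_eq_three
    (hW16 : Wuthrich2014.thm16_halfEigenCharIdeal_dvd_cyclotomicPrime)
    (hmodD : nonempty_modularParametrizationData)
    (hGZK : rank_eq_analyticRank_of_analyticRank_le_one) (hmod : hasEntireLFunction_rat)
    (hp4 : p % 4 = 3) (hX : ClassX3M W p) (hr : W.analyticRank = 1)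
    (hrec : CensusQ6.MultOddFirstUnitIndexAt W p 1)
    {Dh : PAdicHeightData W p} (hB : LeadingTermClauses W p Dh)
    {q : ℚ} (hLq : W.leadingLCoeff = (q : ℂ) * (W.realPeriodRat : ℂ) * (W.regulator : ℂ)) :
    BSDp W p ↔ padicValRat p q + (padicRegulator Dh).valuation = 1 :=
  hX.bsdp_iff_padicVal_rankOne_of_wuthrichHalf_of_multCert hW16 hmodD hGZK hmod hr
    (multBranchUnitCertificateAt_of_firstUnitIndex_one_of_mod_four_eq_three hmod hp4 hX.potMult.1
      (entireLFunction_one_eq_zero_of_analyticRank_ne_zero hmod (by rw [hr]; exact one_ne_zero)) hrec)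
    hB hLq

end OddBranch

/-! ### §4 `p = 3` (the n1011 rows): the (M) rank-one line at `3`, quoted Pal-free -/

section Three

variable {W : WeierstrassCurve ℚ} [W.IsElliptic] [W.IsGloballyMinimal] [hp : Fact (Nat.Prime 3)]

/-- **X4(M)@3 ∩ {`ρ̄₃` onto}, `r_an = 1`, Pal-free**: Kato `hK` + the Q6 record
`CensusQ6.MultOddFirstUnitIndexAt W 3 1` (first unit coefficient of `ϖ·L₃⁻(f♭, a₃, ω, T)` at index `1`)
⟹ `BSD(E,3) ⟺ ord₃ q + ord₃ Reg₃(E,Dh) = 1`. [cite: Kato2004Asterisque, Thm. 17.4 (3) (p. 273)]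
[cite: Delbourgo2002, Theorem (B) (p. 40)] [cite: Miller2011LMS, Def. 1.1] -/
theorem ClassX4M.bsdp_three_iff_padicVal_rankOne_of_katoHalf_of_firstUnitIndex_one
    (hK : Wuthrich2014.kato_halfEigenCharIdeal_dvd_cyclotomicPrime_of_surjective)
    (hmodD : nonempty_modularParametrizationData)
    (hGZK : rank_eq_analyticRank_of_analyticRank_le_one) (hmod : hasEntireLFunction_rat)
    (hX : ClassX4M W 3) (hsurj : Surj W 3) (hr : W.analyticRank = 1)
    (hrec : CensusQ6.MultOddFirstUnitIndexAt W 3 1)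
    {Dh : PAdicHeightData W 3} (hB : LeadingTermClauses W 3 Dh)
    {q : ℚ} (hLq : W.leadingLCoeff = (q : ℂ) * (W.realPeriodRat : ℂ) * (W.regulator : ℂ)) :
    BSDp W 3 ↔ padicValRat 3 q + (padicRegulator Dh).valuation = 1 :=
  hX.bsdp_iff_padicVal_rankOne_of_katoHalf_of_firstUnitIndex_one_of_mod_four_eq_three hK hmodD hGZK
    hmod (by decide) hsurj hr hrec hB hLq

/-- **X4(M)@3 ∩ {`ρ̄₃` onto}, `r_an = 1`, Pal-free, one-number form**: Kato `hK` + ONE `3`-adic unit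
linear coefficient on every multiplicative model of `E ⊗ χ_{−3}` (census-literal odd shape) ⟹
`BSD(E,3) ⟺ ord₃ q + ord₃ Reg₃(E,Dh) = 1`. [cite: Kato2004Asterisque, Thm. 17.4 (3) (p. 273)]
[cite: Delbourgo2002, Theorem (B) (p. 40)] [cite: Miller2011LMS, Def. 1.1] -/
theorem ClassX4M.bsdp_three_iff_padicVal_rankOne_of_katoHalf_of_norm_minusCoeff_one
    (hK : Wuthrich2014.kato_halfEigenCharIdeal_dvd_cyclotomicPrime_of_surjective)
    (hmodD : nonempty_modularParametrizationData)
    (hGZK : rank_eq_analyticRank_of_analyticRank_le_one) (hmod : hasEntireLFunction_rat)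
    (hX : ClassX4M W 3) (hsurj : Surj W 3) (hr : W.analyticRank = 1)
    (hone : ∀ (V : WeierstrassCurve ℚ) [V.IsElliptic] [V.IsGloballyMinimal] (C : VariableChange ℚ),
      Mult V 3 → C • V.quadraticTwist (-(3 : ℚ)) = W →
      ∀ {N : ℕ} [NeZero N] (f : CuspForm (Gamma0 N) 2), IsNewformOf V f → ∀ (ap : ℤ), cuspCoeff f 3 = ap →
      ∀ ϖ : ℚ, (ϖ : ℝ) * V.imaginaryPeriodRat = minusPeriod f →
        ‖PowerSeries.coeff 1 (PowerSeries.C (ϖ : ℚ_[3]) *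
            padicLFunctionMinusBranchMult f (ap : ℚ_[3]) (3 / 2))‖ = 1)
    {Dh : PAdicHeightData W 3} (hB : LeadingTermClauses W 3 Dh)
    {q : ℚ} (hLq : W.leadingLCoeff = (q : ℂ) * (W.realPeriodRat : ℂ) * (W.regulator : ℂ)) :
    BSDp W 3 ↔ padicValRat 3 q + (padicRegulator Dh).valuation = 1 :=
  hX.bsdp_iff_padicVal_rankOne_of_katoHalf_of_multCert hK hmodD hGZK hmod hsurj hr
    (multBranchUnitCertificateAt_of_norm_minusCoeff_one hmod (by decide) hX.classX4.2.1
      (entireLFunction_one_eq_zero_of_analyticRank_ne_zero hmod (by rw [hr]; exact one_ne_zero))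
      (by exact_mod_cast hone))
    hB hLq

/-- **X3♯(M)@3, `r_an = 1`, Pal-free** (Wuthrich Thm. 16, NO surj): the Q6 record
`CensusQ6.MultOddFirstUnitIndexAt W 3 1` ⟹ `BSD(E,3) ⟺ ord₃ q + ord₃ Reg₃(E,Dh) = 1` (the one-number
form: feed `multOddFirstUnitIndexAt_one_of_norm_minusCoeff_one` for `hrec`).
[cite: Wuthrich2014, Thm. 16 (p. 397)] [cite: Delbourgo2002, Theorem (B) (p. 40)] [cite: Miller2011LMS, Def. 1.1] -/
theorem ClassX3M.bsdp_three_iff_padicVal_rankOne_of_wuthrichHalf_of_firstUnitIndex_one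
    (hW16 : Wuthrich2014.thm16_halfEigenCharIdeal_dvd_cyclotomicPrime)
    (hmodD : nonempty_modularParametrizationData)
    (hGZK : rank_eq_analyticRank_of_analyticRank_le_one) (hmod : hasEntireLFunction_rat)
    (hX : ClassX3M W 3) (hr : W.analyticRank = 1)
    (hrec : CensusQ6.MultOddFirstUnitIndexAt W 3 1)
    {Dh : PAdicHeightData W 3} (hB : LeadingTermClauses W 3 Dh)
    {q : ℚ} (hLq : W.leadingLCoeff = (q : ℂ) * (W.realPeriodRat : ℂ) * (W.regulator : ℂ)) :
    BSDp W 3 ↔ padicValRat 3 q + (padicRegulator Dh).valuation = 1 :=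
  hX.bsdp_iff_padicVal_rankOne_of_wuthrichHalf_of_firstUnitIndex_one_of_mod_four_eq_three hW16 hmodD
    hGZK hmod (by decide) hr hrec hB hLq

end Three

end Summit.BirchSwinnertonDyer.Rank1Residual.AdditivePotMult

end
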